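import Summits.QuantumFields.BalabanUV.T4Continuum.Spine.NE1p.B7AveragingRayCauchyBound

/-!
# T⁴ programme, spine estimate NE1′ (node O3b/H2) — DOOR (c) AT LEVEL 1: the quadratic term of the covariant block-average
# logarithm at a CURVED background differs from its flat value by `≲ a²·b` — «diagonal curvature ∝ non-flatness»

Cell `pub-balaban-gaps` (YM blitz Y1, track G2), seat `ne1` gen 10 (prover-pub-balaban-gaps-ne1-g10-0); record `HOME/ne/NE1.md` v10.x R61
∕ `HOME/pub-balaban-gaps-ne1/gen10/R61-PLAN.md` statement (∗).  ADDITIVE — imports this seat's `B7AveragingRayCauchyBound` (gen 10) and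
through it `B7AveragingComplexRaySize`, file 8 and the lineages' objects BY NAME; Mathlib's Cauchy estimates
(`Complex.norm_deriv_le_of_forall_mem_sphere_norm_le`, `Complex.norm_iteratedDeriv_le_of_forall_mem_sphere_norm_le`), the mean
value inequality `Convex.norm_image_sub_le_of_norm_deriv_le`, and `DifferentiableOn.analyticAt`; 0 def.

THE ARGUMENT (route (ii) of R61-PLAN WITHOUT several-variable analyticity).  `G(s,t) := log( Ū_c(e^{tA}e^{sB}) · Ū_c(e^{sB})⁻¹ )`,
`K(s) := ∂_t²|₀ G(s,t)`.  (1) HOLOMORPHY IN `s` at fixed `t` (§1; the mirror of file 15 §2) and Cauchy with `n = 1` on discs of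
radius `R₁` around the points of the segment `[0,1]`, where `‖G‖ ≤ 1` (file 15): `‖∂_s G‖ ≤ 1∕R₁`, so by the mean value inequality
`‖G(1,t) − G(0,t)‖ ≤ 1∕R₁` for every `t` of the disc `‖t‖ ≤ ρ` (§2).  (2) The DIFFERENCE `t ↦ G(1,t) − G(0,t)` is holomorphic on that
disc and bounded by `1∕R₁` on its boundary circle, so Cauchy with `n = 2` gives `‖∂_t²|₀(G(1,·) − G(0,·))‖ ≤ 2∕(ρ²R₁)`; both `G(1,·)`,
`G(0,·)` are analytic at `0` (`DifferentiableOn.analyticAt`), so the left side is `K(1) − K(0)` (`iteratedDeriv_sub`) (§3).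
(3) Radii `ρ = 1∕(80ℓa)`, `R₁ = 1∕(80ℓb)` fit the polydisc `ℓ(‖t‖a + ‖s‖b) ≤ 1∕20` when `ℓb ≤ 1∕80` (§4).

WHAT THIS FILE PROVES (0 sorry).  `ℓ = 2dL + 2L`, `L ≥ 1`, `‖A(b)‖ ≤ a`, `‖B(b)‖ ≤ b`:
* §1 `differentiable_hol_ray_snd`, `differentiableAt_bavg_ray_snd`, `differentiableAt_mlog_ray_ratio_snd` — holomorphy in `s`.
* §2 **`norm_mlog_ray_ratio_sub_flat_le` — `‖G(1,t) − G(0,t)‖ ≤ 1∕R₁`** for `‖t‖ ≤ ρ`, `0 < R₁`, `ℓ(ρa + (1+R₁)b) ≤ 1∕20`.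
* §3 **`norm_iteratedDeriv_two_mlog_ratio_sub_flat_le` — `‖K(1) − K(0)‖ ≤ 2∕(ρ²R₁)`** under the same hypotheses, `0 < ρ`.
* §4 **`norm_curvature_sub_flat_le` — for `0 < a`, `0 < b`, `ℓ·b ≤ 1∕80`:
  `‖∂_t²|₀ log(Ū_c(e^{tA}e^{B})Ū_c(e^{B})⁻¹) − ∂_t²|₀ log Ū_c(e^{tA})‖ ≤ 1024000·ℓ³·a²·b`**, and
  **`norm_curvature_le_of_commute` — if the values of `A` pairwise commute (every ONE-PARAMETER SLOT), then
  `‖∂_t²|₀ log(Ū_c(e^{tA}e^{B})Ū_c(e^{B})⁻¹)‖ ≤ 1024000·ℓ³·a²·b`**: the DIAGONAL CURVATURE of Bałaban's one-step average in a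
  one-parameter slot at the background `e^{B}` is bounded by (slot amplitude)² × (size of the background generator) — with `B` the
  axial-gauge generator of a background whose plaquette variables are near `1` (`‖B‖ ≲ L²·sup_p‖U₀(∂p) − 1‖`, [B7] (44) KIND; the gauge
  step itself is file 13's pattern and is NOT done here), this is «diagonal curvature ∝ non-flatness» AT LEVEL 1 with crude constants.
What it does NOT do: the gauge-fixing step `U₀ = (e^{B})^{u}` on the block, higher levels `j`, sharp constants, RG densities (α).

HONEST FRAMING.  [folklore] complex analysis on the printed objects; nothing of Bałaban's asserted; NE1′ NOT proved; spine 0∕9; (B) 0∕13;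
binders 0∕6; one fixed finite T⁴ — NOT ℝ⁴, NOT infinite volume, NOT a mass gap, NOT Clay.
-/

noncomputable section

open scoped Topology
open NormedSpace Filter Metric

namespace Summit.QuantumFields.BalabanUV.T4Continuum.NE1p.B7AveragingCommutator

open Literature.MathematicalPhysics.QuantumFieldTheory.Balaban1983to89.MatrixLog (mlog analyticAt_mlog norm_mlog_le_two_mul)
open Literature.MathematicalPhysics.QuantumFieldTheory.Balaban1983to89.B7Prop1Explicit
open Literature.MathematicalPhysics.QuantumFieldTheory.Balaban1983to89.B7Prop3Flat (expCfg val_bavg)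
open Literature.MathematicalPhysics.QuantumFieldTheory.Balaban1983to89.B7Prop3GeneralRotated (expCfg_zero)
open Literature.MathematicalPhysics.QuantumFieldTheory.Balaban1983to89.B8Ineq130 (bavg_one)

variable {𝔸 : Type*} [NormedRing 𝔸] [NormedAlgebra ℂ 𝔸] [CompleteSpace 𝔸]

/-! ## §1 Holomorphy in the background parameter `s` -/

section HoloS

variable {d : ℕ} (A B : Site d → Fin d → 𝔸) (t : ℂ)

/-- Every letter of `e^{tA}e^{sB}` is an entire function of `s`. [folklore] -/
theorem differentiable_stepHol_ray_snd (x : Site d) (l : Letter d) :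
    Differentiable ℂ (fun s : ℂ => ((stepHol (expCfg (t • A) * expCfg (s • B)) x l : 𝔸ˣ) : 𝔸)) := by
  have hexp : ∀ (X : 𝔸), Differentiable ℂ (fun s : ℂ => exp (s • X)) := fun X s =>
    (hasDerivAt_exp_smul_const' X s).differentiableAt
  obtain ⟨μ, c⟩ := l
  cases c
  · have e1 : (fun s : ℂ => ((stepHol (expCfg (t • A) * expCfg (s • B)) x (μ, false) : 𝔸ˣ) : 𝔸))
        = fun s : ℂ => exp (-(s • B (x - e μ) μ)) * exp (-(t • A (x - e μ) μ)) := by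
      funext s
      rw [stepHol_false]
      have e2 : ((expCfg (t • A) * expCfg (s • B)) (x - e μ) μ)⁻¹
          = (expUnit ((s • B) (x - e μ) μ))⁻¹ * (expUnit ((t • A) (x - e μ) μ))⁻¹ := by
        rw [Pi.mul_apply, Pi.mul_apply, mul_inv_rev]; rfl
      rw [e2, Units.val_mul, val_inv_expUnit, val_inv_expUnit, val_expUnit, val_expUnit]; rfl
    rw [e1]
    simp_rw [← smul_neg]
    exact (hexp _).mul (differentiable_const _)
  · have e1 : (fun s : ℂ => ((stepHol (expCfg (t • A) * expCfg (s • B)) x (μ, true) : 𝔸ˣ) : 𝔸))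
        = fun s : ℂ => exp (t • A x μ) * exp (s • B x μ) := by
      funext s
      rw [stepHol_true]
      have e2 : (expCfg (t • A) * expCfg (s • B)) x μ = expUnit ((t • A) x μ) * expUnit ((s • B) x μ) := by
        rw [Pi.mul_apply, Pi.mul_apply]; rfl
      rw [e2, Units.val_mul, val_expUnit, val_expUnit]; rfl
    rw [e1]
    exact (differentiable_const _).mul (hexp _)

/-- Word transports of `e^{tA}e^{sB}` are entire in `s`. [cite: Balaban1985Averaging, (9) p.18] -/
theorem differentiable_hol_ray_snd :
    ∀ (w : List (Letter d)) (x : Site d),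
      Differentiable ℂ (fun s : ℂ => ((hol (expCfg (t • A) * expCfg (s • B)) x w : 𝔸ˣ) : 𝔸))
  | [], x => by simp
  | l :: w, x => by
    have e1 : (fun s : ℂ => ((hol (expCfg (t • A) * expCfg (s • B)) x (l :: w) : 𝔸ˣ) : 𝔸))
        = fun s : ℂ => ((stepHol (expCfg (t • A) * expCfg (s • B)) x l : 𝔸ˣ) : 𝔸)
            * ((hol (expCfg (t • A) * expCfg (s • B)) (x + l.vec) w : 𝔸ˣ) : 𝔸) := by
      funext s; rw [hol_cons, Units.val_mul]
    rw [e1]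
    exact (differentiable_stepHol_ray_snd A B t x l).mul (differentiable_hol_ray_snd w (x + l.vec))

variable {A B} {a b : ℝ} (ha : ∀ (y : Site d) (μ : Fin d), ‖A y μ‖ ≤ a) (hb : ∀ (y : Site d) (μ : Fin d), ‖B y μ‖ ≤ b)
  (hann : 0 ≤ a) (hbnn : 0 ≤ b)

include ha hb hann hbnn

/-- `Ū_c(e^{tA}e^{sB})` is complex-differentiable in `s` at every point of the polydisc `ℓ(‖t‖a + ‖s‖b) ≤ 1∕5`.
[cite: Balaban1985Averaging, (21) p.21, (42) p.23] -/
theorem differentiableAt_bavg_ray_snd (L : ℕ) (s : ℂ) (h : (2 * d * L + 2 * L) * (‖t‖ * a + ‖s‖ * b) ≤ 1 / 5)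
    (q : Site d) (κ : Fin d) :
    DifferentiableAt ℂ (fun u : ℂ => ((bavg L (expCfg (t • A) * expCfg (u • B)) q κ : 𝔸ˣ) : 𝔸)) s := by
  simp_rw [val_bavg]
  refine DifferentiableAt.mul ?_ ((differentiable_hol_ray_snd A B t (seg κ L) q) s)
  refine ((NormedSpace.exp_analytic (𝕂 := ℂ) _).differentiableAt).comp s ?_
  unfold Xavg
  refine DifferentiableAt.fun_sum fun r _ => DifferentiableAt.const_smul ?_ _
  have hW : DifferentiableAt ℂ
      (fun u : ℂ => ((Wcx L (expCfg (t • A) * expCfg (u • B)) q κ (boxVec L r) : 𝔸ˣ) : 𝔸)) s := by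
    simp_rw [Wcx_eq_hol_loop]; exact (differentiable_hol_ray_snd A B t _ q) s
  have hm : DifferentiableAt ℂ (mlog : 𝔸 → 𝔸) ((Wcx L (expCfg (t • A) * expCfg (s • B)) q κ (boxVec L r) : 𝔸ˣ) : 𝔸) :=
    (analyticAt_mlog ((norm_Wcx_ray_sub_one_lt ha hb hann hbnn L s t h q κ r).trans (by norm_num))).differentiableAt
  have hc := hm.comp s hW
  simpa [Function.comp_def] using hc

/-- **`s ↦ log( Ū_c(e^{tA}e^{sB}) · Ū_c(e^{sB})⁻¹ )` is complex-differentiable at every `s` with `ℓ(‖t‖a + ‖s‖b) ≤ 1∕20`**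
(both factors depend on `s`; the inverse through Mathlib's `hasFDerivAt_ringInverse`). [cite: Balaban1985Averaging, (21) p.21, (42) p.23] -/
theorem differentiableAt_mlog_ray_ratio_snd (L : ℕ) (hL : 1 ≤ L) (s : ℂ)
    (h : (2 * d * L + 2 * L) * (‖t‖ * a + ‖s‖ * b) ≤ 1 / 20) (q : Site d) (κ : Fin d) :
    DifferentiableAt ℂ (fun u : ℂ =>
      mlog (((bavg L (expCfg (t • A) * expCfg (u • B)) q κ * (bavg L (expCfg (u • B)) q κ)⁻¹ : 𝔸ˣ) : 𝔸))) s := by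
  have hR := norm_ray_ratio_sub_one_le_half ha hb hann hbnn L hL s t h q κ
  -- the background factor `u ↦ Ū_c(e^{uB})` is the ray at `t = 0`
  have hs0 : (2 * d * L + 2 * L) * (‖(0 : ℂ)‖ * a + ‖s‖ * b) ≤ 1 / 5 := by
    have : (0 : ℝ) ≤ (2 * d * L + 2 * L) * (‖t‖ * a) := by positivity
    rw [norm_zero, zero_mul, zero_add]; nlinarith
  have hB0 : DifferentiableAt ℂ (fun u : ℂ => ((bavg L (expCfg (u • B)) q κ : 𝔸ˣ) : 𝔸)) s := by
    have h' := differentiableAt_bavg_ray_snd (t := 0) ha hb hann hbnn L s hs0 q κ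
    simpa only [zero_smul, expCfg_zero, one_mul] using h'
  have hBinv : DifferentiableAt ℂ (fun u : ℂ => (((bavg L (expCfg (u • B)) q κ)⁻¹ : 𝔸ˣ) : 𝔸)) s := by
    have e : (fun u : ℂ => (((bavg L (expCfg (u • B)) q κ)⁻¹ : 𝔸ˣ) : 𝔸))
        = fun u : ℂ => Ring.inverse ((bavg L (expCfg (u • B)) q κ : 𝔸ˣ) : 𝔸) := by
      funext u; rw [Ring.inverse_unit]
    rw [e]
    exact ((hasFDerivAt_ringInverse (𝕜 := ℂ) (bavg L (expCfg (s • B)) q κ)).differentiableAt).comp s hB0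
  have hdiff : DifferentiableAt ℂ (fun u : ℂ =>
      (((bavg L (expCfg (t • A) * expCfg (u • B)) q κ * (bavg L (expCfg (u • B)) q κ)⁻¹ : 𝔸ˣ) : 𝔸))) s := by
    simp_rw [Units.val_mul]
    exact (differentiableAt_bavg_ray_snd t ha hb hann hbnn L s (by linarith) q κ).mul hBinv
  have hm : DifferentiableAt ℂ (mlog : 𝔸 → 𝔸)
      (((bavg L (expCfg (t • A) * expCfg (s • B)) q κ * (bavg L (expCfg (s • B)) q κ)⁻¹ : 𝔸ˣ) : 𝔸)) :=
    (analyticAt_mlog (hR.trans_lt (by norm_num))).differentiableAt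
  have hc := hm.comp s hdiff
  simpa [Function.comp_def] using hc

end HoloS

/-! ## §2 The mean-value step in `s` -/

section MeanValue

variable {d : ℕ} {A B : Site d → Fin d → 𝔸} {a b : ℝ}
  (ha : ∀ (y : Site d) (μ : Fin d), ‖A y μ‖ ≤ a) (hb : ∀ (y : Site d) (μ : Fin d), ‖B y μ‖ ≤ b) (hann : 0 ≤ a) (hbnn : 0 ≤ b)

include ha hb hann hbnn

/-- **`‖G(1,t) − G(0,t)‖ ≤ 1∕R₁`** for `‖t‖ ≤ ρ`, where `G(s,t) = log(Ū_c(e^{tA}e^{sB})Ū_c(e^{sB})⁻¹)`, provided `0 < R₁` and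
`ℓ(ρa + (1+R₁)b) ≤ 1∕20`: Cauchy (`n = 1`) on the disc of radius `R₁` around each point of the segment `[0,1]` (where `‖G‖ ≤ 1`,
file 15) bounds `‖∂_s G‖ ≤ 1∕R₁`, and the mean value inequality on the segment concludes. [folklore] -/
theorem norm_mlog_ray_ratio_sub_flat_le (L : ℕ) (hL : 1 ≤ L) {ρ R₁ : ℝ} (hR₁ : 0 < R₁)
    (h : (2 * d * L + 2 * L) * (ρ * a + (1 + R₁) * b) ≤ 1 / 20) (t : ℂ) (ht : ‖t‖ ≤ ρ) (q : Site d) (κ : Fin d) :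
    ‖mlog (((bavg L (expCfg (t • A) * expCfg ((1 : ℂ) • B)) q κ * (bavg L (expCfg ((1 : ℂ) • B)) q κ)⁻¹ : 𝔸ˣ) : 𝔸))
        - mlog (((bavg L (expCfg (t • A) * expCfg ((0 : ℂ) • B)) q κ * (bavg L (expCfg ((0 : ℂ) • B)) q κ)⁻¹ : 𝔸ˣ) : 𝔸))‖
      ≤ 1 / R₁ := by
  set G : ℂ → 𝔸 := fun u : ℂ =>
    mlog (((bavg L (expCfg (t • A) * expCfg (u • B)) q κ * (bavg L (expCfg (u • B)) q κ)⁻¹ : 𝔸ˣ) : 𝔸)) with hG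
  have hℓ : (0 : ℝ) ≤ 2 * d * L + 2 * L := by positivity
  -- the polydisc condition at every `s` with `‖s‖ ≤ 1 + R₁`
  have hpoly : ∀ s : ℂ, ‖s‖ ≤ 1 + R₁ → (2 * d * L + 2 * L) * (‖t‖ * a + ‖s‖ * b) ≤ 1 / 20 := by
    intro s hs
    have h1 : ‖t‖ * a + ‖s‖ * b ≤ ρ * a + (1 + R₁) * b := by gcongr
    exact (mul_le_mul_of_nonneg_left h1 hℓ).trans h
  -- differentiability on the segment and the derivative bound by Cauchy (n = 1)
  have hseg : ∀ s ∈ segment ℝ (0 : ℂ) 1, ‖s‖ ≤ 1 := by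
    intro s hs
    rcases hs with ⟨p, r, hp, hr, hpr, rfl⟩
    simp only [smul_zero, zero_add, norm_smul, mul_one, Real.norm_eq_abs, abs_of_nonneg hr, norm_one]
    linarith
  have hdiffAt : ∀ s : ℂ, ‖s‖ ≤ 1 + R₁ → DifferentiableAt ℂ G s := fun s hs =>
    differentiableAt_mlog_ray_ratio_snd (t := t) ha hb hann hbnn L hL s (hpoly s hs) q κ
  have hbound : ∀ s ∈ segment ℝ (0 : ℂ) 1, ‖deriv G s‖ ≤ 1 / R₁ := by
    intro s hs
    have hs1 := hseg s hs
    have hdisc : DifferentiableOn ℂ G (closedBall s R₁) := fun w hw => by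
      refine (hdiffAt w ?_).differentiableWithinAt
      have hw' : ‖w - s‖ ≤ R₁ := by simpa [dist_eq_norm] using hw
      calc ‖w‖ = ‖s + (w - s)‖ := by rw [add_sub_cancel]
        _ ≤ ‖s‖ + ‖w - s‖ := norm_add_le _ _
        _ ≤ 1 + R₁ := add_le_add hs1 hw'
    have hC : ∀ w ∈ sphere s R₁, ‖G w‖ ≤ 1 := by
      intro w hw
      have hw' : ‖w - s‖ = R₁ := by simpa [dist_eq_norm] using hw
      have hw1 : ‖w‖ ≤ 1 + R₁ := by
        calc ‖w‖ = ‖s + (w - s)‖ := by rw [add_sub_cancel]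
          _ ≤ ‖s‖ + ‖w - s‖ := norm_add_le _ _
          _ ≤ 1 + R₁ := by rw [hw']; exact add_le_add hs1 le_rfl
      have hR := norm_ray_ratio_sub_one_le_half ha hb hann hbnn L hL w t (hpoly w hw1) q κ
      exact (norm_mlog_le_two_mul hR).trans (by linarith)
    exact Complex.norm_deriv_le_of_forall_mem_sphere_norm_le hR₁ (hdisc.diffContOnCl_ball subset_rfl) hC
  have hmv := Convex.norm_image_sub_le_of_norm_deriv_le (fun s hs => hdiffAt s ((hseg s hs).trans (by linarith)))
    hbound (convex_segment (0 : ℂ) 1) (left_mem_segment ℝ (0 : ℂ) 1) (right_mem_segment ℝ (0 : ℂ) 1)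
  simpa [hG] using hmv

end MeanValue

/-! ## §3 Cauchy in `t` for the difference, and the identification with `K(1) − K(0)` -/

section Difference

variable {d : ℕ} {A B : Site d → Fin d → 𝔸} {a b : ℝ}
  (ha : ∀ (y : Site d) (μ : Fin d), ‖A y μ‖ ≤ a) (hb : ∀ (y : Site d) (μ : Fin d), ‖B y μ‖ ≤ b) (hann : 0 ≤ a) (hbnn : 0 ≤ b)

include ha hb hann hbnn

/-- `t ↦ G(s,t)` is analytic at `0` (holomorphic on the open disc `‖t‖ < ρ`, `DifferentiableOn.analyticAt`), for `‖s‖b` inside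
the polydisc budget. [folklore] -/
theorem analyticAt_mlog_ray_ratio (L : ℕ) (hL : 1 ≤ L) (s : ℂ) {ρ : ℝ} (hρ : 0 < ρ)
    (h : (2 * d * L + 2 * L) * (ρ * a + ‖s‖ * b) ≤ 1 / 20) (q : Site d) (κ : Fin d) :
    AnalyticAt ℂ (fun u : ℂ =>
      mlog (((bavg L (expCfg (u • A) * expCfg (s • B)) q κ * (bavg L (expCfg (s • B)) q κ)⁻¹ : 𝔸ˣ) : 𝔸))) 0 := by
  have hℓ : (0 : ℝ) ≤ 2 * d * L + 2 * L := by positivity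
  have hdiffOn : DifferentiableOn ℂ (fun u : ℂ =>
      mlog (((bavg L (expCfg (u • A) * expCfg (s • B)) q κ * (bavg L (expCfg (s • B)) q κ)⁻¹ : 𝔸ˣ) : 𝔸))) (ball (0 : ℂ) ρ) := by
    intro t ht
    refine (differentiableAt_mlog_ray_ratio s ha hb hann hbnn L hL t ?_ q κ).differentiableWithinAt
    have ht' : ‖t‖ ≤ ρ := by simpa using (mem_ball_zero_iff.1 ht).le
    have h1 : ‖t‖ * a + ‖s‖ * b ≤ ρ * a + ‖s‖ * b := by gcongr
    exact (mul_le_mul_of_nonneg_left h1 hℓ).trans h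
  exact hdiffOn.analyticAt (ball_mem_nhds 0 hρ)

/-- **`‖K(1) − K(0)‖ ≤ 2∕(ρ²R₁)`**: the difference `t ↦ G(1,t) − G(0,t)` is holomorphic on the closed disc of radius `ρ` and bounded
there by `1∕R₁` (§2), so Cauchy with `n = 2` bounds its second derivative at `0`; both terms being analytic at `0`, that second
derivative is `K(1) − K(0)` (`iteratedDeriv_sub`). Hypotheses: `0 < ρ`, `0 < R₁`, `ℓ(ρa + (1+R₁)b) ≤ 1∕20`. [folklore] -/
theorem norm_iteratedDeriv_two_mlog_ratio_sub_flat_le (L : ℕ) (hL : 1 ≤ L) {ρ R₁ : ℝ} (hρ : 0 < ρ) (hR₁ : 0 < R₁)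
    (h : (2 * d * L + 2 * L) * (ρ * a + (1 + R₁) * b) ≤ 1 / 20) (q : Site d) (κ : Fin d) :
    ‖iteratedDeriv 2 (fun u : ℂ =>
          mlog (((bavg L (expCfg (u • A) * expCfg ((1 : ℂ) • B)) q κ * (bavg L (expCfg ((1 : ℂ) • B)) q κ)⁻¹ : 𝔸ˣ) : 𝔸))) 0
        - iteratedDeriv 2 (fun u : ℂ =>
          mlog (((bavg L (expCfg (u • A) * expCfg ((0 : ℂ) • B)) q κ * (bavg L (expCfg ((0 : ℂ) • B)) q κ)⁻¹ : 𝔸ˣ) : 𝔸))) 0‖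
      ≤ 2 / (ρ ^ 2 * R₁) := by
  set G1 : ℂ → 𝔸 := fun u : ℂ =>
    mlog (((bavg L (expCfg (u • A) * expCfg ((1 : ℂ) • B)) q κ * (bavg L (expCfg ((1 : ℂ) • B)) q κ)⁻¹ : 𝔸ˣ) : 𝔸)) with hG1
  set G0 : ℂ → 𝔸 := fun u : ℂ =>
    mlog (((bavg L (expCfg (u • A) * expCfg ((0 : ℂ) • B)) q κ * (bavg L (expCfg ((0 : ℂ) • B)) q κ)⁻¹ : 𝔸ˣ) : 𝔸)) with hG0
  have hℓ : (0 : ℝ) ≤ 2 * d * L + 2 * L := by positivity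
  have hb1 : (2 * d * L + 2 * L) * (ρ * a + ‖(1 : ℂ)‖ * b) ≤ 1 / 20 := by
    rw [norm_one, one_mul]
    have : ρ * a + b ≤ ρ * a + (1 + R₁) * b := by nlinarith
    exact (mul_le_mul_of_nonneg_left this hℓ).trans h
  have hb0 : (2 * d * L + 2 * L) * (ρ * a + ‖(0 : ℂ)‖ * b) ≤ 1 / 20 := by
    rw [norm_zero, zero_mul, add_zero]
    have : ρ * a ≤ ρ * a + (1 + R₁) * b := by nlinarith
    exact (mul_le_mul_of_nonneg_left this hℓ).trans h
  have hA1 := analyticAt_mlog_ray_ratio ha hb hann hbnn L hL (1 : ℂ) hρ hb1 q κ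
  have hA0 := analyticAt_mlog_ray_ratio ha hb hann hbnn L hL (0 : ℂ) hρ hb0 q κ
  -- holomorphy of both on the closed disc and of the difference
  have hpt : ∀ (s : ℂ), (2 * d * L + 2 * L) * (ρ * a + ‖s‖ * b) ≤ 1 / 20 → ∀ t : ℂ, ‖t‖ ≤ ρ →
      (2 * d * L + 2 * L) * (‖t‖ * a + ‖s‖ * b) ≤ 1 / 20 := by
    intro s hs t ht
    have h1 : ‖t‖ * a + ‖s‖ * b ≤ ρ * a + ‖s‖ * b := by gcongr
    exact (mul_le_mul_of_nonneg_left h1 hℓ).trans hs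
  have hD1 : DifferentiableOn ℂ G1 (closedBall (0 : ℂ) ρ) := fun t ht =>
    (differentiableAt_mlog_ray_ratio 1 ha hb hann hbnn L hL t (hpt 1 hb1 t (by simpa using ht)) q κ).differentiableWithinAt
  have hD0 : DifferentiableOn ℂ G0 (closedBall (0 : ℂ) ρ) := fun t ht =>
    (differentiableAt_mlog_ray_ratio 0 ha hb hann hbnn L hL t (hpt 0 hb0 t (by simpa using ht)) q κ).differentiableWithinAt
  have hDC : DiffContOnCl ℂ (G1 - G0) (ball (0 : ℂ) ρ) :=
    (hD1.diffContOnCl_ball subset_rfl).sub (hD0.diffContOnCl_ball subset_rfl)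
  have hC : ∀ z ∈ sphere (0 : ℂ) ρ, ‖(G1 - G0) z‖ ≤ 1 / R₁ := by
    intro z hz
    have hz' : ‖z‖ ≤ ρ := by simpa using (mem_sphere_iff_norm.1 hz).le
    simpa [hG1, hG0] using norm_mlog_ray_ratio_sub_flat_le ha hb hann hbnn L hL hR₁ h z hz' q κ
  have hmain := Complex.norm_iteratedDeriv_le_of_forall_mem_sphere_norm_le 2 hρ hDC hC
  rw [iteratedDeriv_sub (hA1.contDiffAt.of_le le_top) (hA0.contDiffAt.of_le le_top)] at hmain
  have e : ((Nat.factorial 2 : ℕ) : ℝ) * (1 / R₁) / ρ ^ 2 = 2 / (ρ ^ 2 * R₁) := by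
    rw [Nat.factorial_two]; push_cast; field_simp
  rw [e] at hmain
  exact hmain

end Difference

/-! ## §4 Constants: «diagonal curvature ∝ non-flatness» at level 1 -/

section Final

variable {d : ℕ} {A B : Site d → Fin d → 𝔸} {a b : ℝ}
  (ha : ∀ (y : Site d) (μ : Fin d), ‖A y μ‖ ≤ a) (hb : ∀ (y : Site d) (μ : Fin d), ‖B y μ‖ ≤ b) (ha0 : 0 < a) (hb0 : 0 < b)

include ha hb ha0 hb0

/-- **THE QUADRATIC TERM AT A CURVED BACKGROUND MINUS ITS FLAT VALUE IS `≲ a²·b`**: for `L ≥ 1`, `ℓ = 2dL+2L`, `0 < a`, `0 < b`,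
`ℓ·b ≤ 1∕80`:
`‖∂_t²|₀ log(Ū_c(e^{tA}e^{B})·Ū_c(e^{B})⁻¹) − ∂_t²|₀ log Ū_c(e^{tA})‖ ≤ 1024000·ℓ³·a²·b`
(§3 with `ρ = 1∕(80ℓa)`, `R₁ = 1∕(80ℓb)`; the flat term is files 8∕12's object since `Ū_c(1) = 1`). Crude constants; the exponents
(`a²`, `b¹`) are the honest ones. [cite: Balaban1985Averaging, (42) p.23, (121) p.36] -/
theorem norm_curvature_sub_flat_le (L : ℕ) (hL : 1 ≤ L) (hB : (2 * d * L + 2 * L) * b ≤ 1 / 80) (q : Site d) (κ : Fin d) :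
    ‖iteratedDeriv 2 (fun u : ℂ =>
          mlog (((bavg L (expCfg (u • A) * expCfg B) q κ * (bavg L (expCfg B) q κ)⁻¹ : 𝔸ˣ) : 𝔸))) 0
        - iteratedDeriv 2 (fun u : ℂ => mlog ((bavg L (expCfg (u • A)) q κ : 𝔸ˣ) : 𝔸)) 0‖
      ≤ 1024000 * (2 * d * L + 2 * L) ^ 3 * a ^ 2 * b := by
  have hℓ : (0 : ℝ) < 2 * d * L + 2 * L := by
    have hL1 : (1 : ℝ) ≤ L := by exact_mod_cast hL
    have : (0 : ℝ) ≤ 2 * d * L := by positivity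
    linarith
  set ℓ : ℝ := 2 * d * L + 2 * L with hℓdef
  set ρ : ℝ := 1 / (80 * ℓ * a) with hρdef
  set R₁ : ℝ := 1 / (80 * ℓ * b) with hR₁def
  have hρ : 0 < ρ := by rw [hρdef]; positivity
  have hR₁ : 0 < R₁ := by rw [hR₁def]; positivity
  have hcond : ℓ * (ρ * a + (1 + R₁) * b) ≤ 1 / 20 := by
    have e1 : ℓ * (ρ * a) = 1 / 80 := by rw [hρdef]; field_simp
    have e2 : ℓ * (R₁ * b) = 1 / 80 := by rw [hR₁def]; field_simp
    nlinarith [e1, e2, hB]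
  have hmain := norm_iteratedDeriv_two_mlog_ratio_sub_flat_le ha hb ha0.le hb0.le L hL hρ hR₁ hcond q κ
  have eflat : (fun u : ℂ => mlog (((bavg L (expCfg (u • A) * expCfg ((0 : ℂ) • B)) q κ
      * (bavg L (expCfg ((0 : ℂ) • B)) q κ)⁻¹ : 𝔸ˣ) : 𝔸)))
      = fun u : ℂ => mlog ((bavg L (expCfg (u • A)) q κ : 𝔸ˣ) : 𝔸) := by
    funext u; simp only [zero_smul, expCfg_zero, mul_one, bavg_one, inv_one]
  rw [one_smul, eflat] at hmain
  have e2 : 2 / (ρ ^ 2 * R₁) = 1024000 * ℓ ^ 3 * a ^ 2 * b := by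
    rw [hρdef, hR₁def]; field_simp; ring
  rw [e2] at hmain
  exact hmain

/-- **«DIAGONAL CURVATURE ∝ NON-FLATNESS» AT LEVEL 1, FOR ONE-PARAMETER SLOTS**: if the values of the slot field `A` pairwise commute
(every one-parameter slot `A = s·X·δ_b`; more generally every abelian sector) then the flat term vanishes (file 8,
`iteratedDeriv_two_mlog_bavg_expCfg_of_commute`) and
`‖∂_t²|₀ log(Ū_c(e^{tA}e^{B})·Ū_c(e^{B})⁻¹)‖ ≤ 1024000·ℓ³·a²·b` for every background generator `B` with `ℓ·sup‖B‖ ≤ 1∕80`: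
the diagonal curvature of the printed one-step average at the background `e^{B}` is at most (slot amplitude)² × (size of the
background generator) — zero at the flat background, and, with `B` the axial-gauge generator of a background with small plaquette
variables (`‖B‖ ≲ L²·sup_p‖U₀(∂p) − 1‖`, [B7] (44) KIND; the gauge step is file 13's pattern), proportional to the NON-FLATNESS.
[cite: Balaban1985Averaging, (42) p.23, (44) p.24, (121) p.36] -/
theorem norm_curvature_le_of_commute (L : ℕ) (hL : 1 ≤ L) (hB : (2 * d * L + 2 * L) * b ≤ 1 / 80)
    (hA : ∀ (x : Site d) (κ : Fin d) (y : Site d) (μ : Fin d), Commute (A x κ) (A y μ)) (q : Site d) (κ : Fin d) :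
    ‖iteratedDeriv 2 (fun u : ℂ =>
          mlog (((bavg L (expCfg (u • A) * expCfg B) q κ * (bavg L (expCfg B) q κ)⁻¹ : 𝔸ˣ) : 𝔸))) 0‖
      ≤ 1024000 * (2 * d * L + 2 * L) ^ 3 * a ^ 2 * b := by
  have h := norm_curvature_sub_flat_le ha hb ha0 hb0 L hL hB q κ
  rwa [iteratedDeriv_two_mlog_bavg_expCfg_of_commute L hA q κ, sub_zero] at h

end Final

end Summit.QuantumFields.BalabanUV.T4Continuum.NE1p.B7AveragingCommutator

end
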